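import Literature.MathematicalPhysics.QuantumFieldTheory.AbelianTorusCochains
import Literature.MathematicalPhysics.QuantumFieldTheory.CubicalCochainsBox
import Literature.MathematicalPhysics.QuantumFieldTheory.LatticeGaugeProofs
import HarnessLib

/-!
# Lattice gauge theory with a finite (abelian) gauge group on the torus: finite sums, plaquette fields, observables

Support file for the low-temperature (contour) expansion of `ℤ_n` lattice gauge theory on the
tori `(ℤ/Lℤ)^d` (discharge of `Literature.Barriers.QuantumFields.ZnHiggsPhaseD4` through the torus
core facts of `DiscreteSubgroupFreezingProofs.lean`). It bridges the tree's measure-theoretic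
torus Wilson theory (`ConstructiveQFTWave0`: `wilsonMeasure`, `wilsonExpectation` on
`GaugeConfig d L G = (edges → G)`, product Haar measure tilted by `e^{-β S}`) to the finite
combinatorics used by the contour expansion when the gauge group `G` is FINITE, and the gauge
configurations to the additive cochain calculus of `AbelianTorusCochains` when `G` is abelian.

## Contents (everything is proved)

* **Finite gauge groups**: for a finite discrete group the normalised Haar measure gives mass
  `|G|⁻¹` to every point (`haarProbability_singleton`), the product Haar measure on the edge
  variables gives mass `|G|^{-#edges}` to every configuration, and the torus Wilson expectation
  of ANY observable is the finite Gibbs average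
  `⟨F⟩_{Λ_L,β} = (∑_U F(U) e^{-β S(U)}) / ∑_U e^{-β S(U)}` (`wilsonExpectation_eq_gibbsAverage`).
* **Plaquette fields** (abelian `G`, additive notation through `Additive G`): the additive link
  field `linkField U` and its plaquette field `plaqField U = res (td₁ (linkField U))`
  (`= Additive.ofMul (plaquetteHolonomy U …)`, `plaqField_apply`), closed by the Bianchi identity
  (`isClosedPl_plaqField`); the map `U ↦ plaqField U` is a group homomorphism of configuration
  spaces, so all its non-empty fibres have the cardinality of its kernel
  (`card_filter_plaqField_eq`), which turns sums over link configurations of functions of the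
  plaquette field into sums over the *exact* plaquette fields (`sum_comp_plaqField`).
* **Abelian Stokes theorem** for Wave 0's rectangle holonomy: `rectangleHolonomy U x i j R T` is
  the product of the plaquette holonomies of the `R T` plaquettes of the rectangle
  (`rectangleHolonomy_eq_prod`, from `AbelianTorusCochains.lineSum_rect_eq_sum_td₁`).
* **Gauge-invariant local observables on `ℤ^d` are functions of the plaquette variables**
  (`IsZdGaugeInvariant.eq_of_plaquette_eq`, from the box Poincaré lemma
  `CubicalCochainsBox.exists_d₀_eq_of_flat_on_box`): two configurations with the same plaquette
  holonomies on a box containing the support of a gauge-invariant cylinder observable give it the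
  same value.

## References

* E. Seiler, *Gauge Theories as a Problem of Constructive Quantum Field Theory and Statistical
  Mechanics*, LNP 159 (1982), Ch. 1 (finite-volume lattice gauge theory). [SeilerLNP1982]
* M. P. Forsström, J. Lenells, F. Viklund, *Wilson loops in finite Abelian lattice gauge
  theories*, AIHP 58 (2022), §2.3–§3 (`μ_{β,N}` as a measure on plaquette configurations).
  [ForsstromLenellsViklund2022]
-/

noncomputable section

open MeasureTheory Finset Function
open scoped ENNReal

namespace Literature.MathematicalPhysics.QuantumFieldTheory

/-! ### Finite discrete gauge groups: Haar measure and torus expectations are finite averages -/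

section FiniteGroup

variable {d L N : ℕ} {G : Type*} [Group G] [Fintype G] [TopologicalSpace G] [DiscreteTopology G]
  [IsTopologicalGroup G] [MeasurableSpace G] [BorelSpace G]

omit [Group G] [Fintype G] [IsTopologicalGroup G] in
/-- On a discrete space with its Borel σ-algebra every set is measurable. [folklore] -/
theorem discreteMeasurableSpace_of_borel : DiscreteMeasurableSpace G := by
  have h : ‹MeasurableSpace G› = ⊤ := (BorelSpace.measurable_eq).trans borel_eq_top_of_discrete
  refine ⟨fun s => ?_⟩
  rw [h]
  exact MeasurableSpace.measurableSet_top

/-- **Haar measure of a finite group is uniform**: the normalised Haar measure gives mass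
`|G|⁻¹` to each point (left invariance makes all point masses equal; they add up to `1`).
[folklore] -/
theorem haarProbability_singleton (g : G) :
    haarProbability G {g} = ((Fintype.card G : ℝ≥0∞))⁻¹ := by
  haveI : DiscreteMeasurableSpace G := discreteMeasurableSpace_of_borel
  haveI : (haarProbability G).IsMulLeftInvariant := by
    unfold haarProbability; infer_instance
  -- all point masses are equal
  have heq : ∀ h : G, haarProbability G {h} = haarProbability G {1} := by
    intro h
    have := measure_preimage_mul (haarProbability G) h⁻¹ ({1} : Set G)
    rw [← this]
    congr 1
    ext x
    simp [eq_comm]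
  -- and they add up to one
  have hsum : ∑ h : G, haarProbability G {h} = 1 := by
    rw [sum_measure_singleton, Finset.coe_univ]
    unfold haarProbability
    exact Measure.haarMeasure_self
  simp only [heq, Finset.sum_const, Finset.card_univ, nsmul_eq_mul] at hsum
  rw [heq]
  rw [mul_comm] at hsum
  exact ENNReal.eq_inv_of_mul_eq_one_left hsum

omit [Group G] [IsTopologicalGroup G] in
/-- The product Haar measure on the edge variables gives mass `|G|^{-#edges}` to every torus
configuration. [folklore] -/
theorem pi_haarProbability_singleton [Group G] [IsTopologicalGroup G] [NeZero L] (U : GaugeConfig d L G) :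
    (Measure.pi fun _ : Edge d L => haarProbability G) {U} =
      (((Fintype.card G : ℝ≥0∞))⁻¹) ^ Fintype.card (Edge d L) := by
  haveI : DiscreteMeasurableSpace G := discreteMeasurableSpace_of_borel
  rw [← Set.univ_pi_singleton U, Measure.pi_pi]
  simp only [haarProbability_singleton, Finset.prod_const, Finset.card_univ]

/-- **Torus expectations over a finite gauge group are finite Gibbs averages**: the torus Wilson
state gives the configuration `U` the probability `e^{-β S(U)} / ∑_V e^{-β S(V)}` (the uniform
product Haar weights cancel). [cite: SeilerLNP1982, Ch. 1 (finite-volume lattice gauge theory: the Gibbs measure)] -/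
theorem wilsonMeasure_real_singleton [NeZero L] (ρ : G →* Matrix (Fin N) (Fin N) ℂ) (β : ℝ)
    (U : GaugeConfig d L G) :
    (wilsonMeasure ρ β).real {U} =
      Real.exp (-β * wilsonAction ρ U) / ∑ V : GaugeConfig d L G, Real.exp (-β * wilsonAction ρ V) := by
  classical
  haveI : DiscreteMeasurableSpace G := discreteMeasurableSpace_of_borel
  set π : Measure (GaugeConfig d L G) := Measure.pi fun _ : Edge d L => haarProbability G with hπ
  set c : ℝ≥0∞ := (((Fintype.card G : ℝ≥0∞))⁻¹) ^ Fintype.card (Edge d L) with hc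
  have hcU : ∀ V : GaugeConfig d L G, π {V} = c := fun V => pi_haarProbability_singleton V
  have hc0 : c ≠ 0 := pow_ne_zero _ (ENNReal.inv_ne_zero.2 (ENNReal.natCast_ne_top _))
  have hctop : c ≠ ⊤ :=
    ENNReal.pow_ne_top (ENNReal.inv_ne_top.2 (by exact_mod_cast Fintype.card_ne_zero))
  set dens : GaugeConfig d L G → ℝ≥0∞ := fun V => ENNReal.ofReal (Real.exp (-β * wilsonAction ρ V))
    with hdens
  -- the weight of a configuration and the partition function as finite sums
  have hW : ∀ V, wilsonWeight (d := d) (L := L) ρ β {V} = dens V * c := by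
    intro V
    rw [wilsonWeight, withDensity_apply _ (MeasurableSet.singleton V), lintegral_singleton, ← hπ,
      hcU]
  have hZ : partitionFunction (d := d) (L := L) ρ β = (∑ V, dens V) * c := by
    rw [partitionFunction, wilsonWeight, withDensity_apply _ MeasurableSet.univ,
      Measure.restrict_univ, ← hπ, lintegral_fintype, Finset.sum_mul]
    simp only [hcU]
    rfl
  -- pass to real numbers
  have hdensR : ∀ V, (dens V).toReal = Real.exp (-β * wilsonAction ρ V) := fun V =>
    ENNReal.toReal_ofReal (Real.exp_nonneg _)
  have hsumR : (∑ V, dens V).toReal = ∑ V : GaugeConfig d L G, Real.exp (-β * wilsonAction ρ V) := by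
    rw [ENNReal.toReal_sum fun V _ => ENNReal.ofReal_ne_top]
    exact Finset.sum_congr rfl fun V _ => hdensR V
  have hcR : 0 < c.toReal := ENNReal.toReal_pos hc0 hctop
  rw [measureReal_def, wilsonMeasure, Measure.smul_apply, smul_eq_mul, ENNReal.toReal_mul,
    ENNReal.toReal_inv, hW, hZ, ENNReal.toReal_mul, ENNReal.toReal_mul, hdensR, hsumR]
  have hS : 0 < ∑ V : GaugeConfig d L G, Real.exp (-β * wilsonAction ρ V) :=
    Finset.sum_pos (fun V _ => Real.exp_pos _) Finset.univ_nonempty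
  field_simp

/-- **Torus Wilson expectations over a finite gauge group are Gibbs averages**:
`⟨F⟩_{Λ_L,β} = (∑_U F(U) e^{-β S(U)}) / ∑_U e^{-β S(U)}` for every observable `F`
(no measurability or integrability conditions: everything is finite). [cite: SeilerLNP1982, Ch. 1 (finite-volume lattice gauge theory: the Gibbs measure)] -/
theorem wilsonExpectation_eq_gibbsAverage [NeZero L] (ρ : G →* Matrix (Fin N) (Fin N) ℂ)
    (hρ : Continuous ρ) (β : ℝ) (F : GaugeConfig d L G → ℝ) :
    wilsonExpectation ρ β F =
      (∑ U : GaugeConfig d L G, F U * Real.exp (-β * wilsonAction ρ U)) /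
        ∑ U : GaugeConfig d L G, Real.exp (-β * wilsonAction ρ U) := by
  classical
  haveI : DiscreteMeasurableSpace G := discreteMeasurableSpace_of_borel
  haveI := isProbabilityMeasure_wilsonMeasure (d := d) (L := L) ρ hρ β
  unfold wilsonExpectation
  rw [integral_fintype (Integrable.of_finite), Finset.sum_div]
  refine Finset.sum_congr rfl fun U _ => ?_
  rw [wilsonMeasure_real_singleton, smul_eq_mul]
  ring

end FiniteGroup

/-! ### Abelian gauge groups: link and plaquette fields as additive cochains -/

section Abelian

open LatticeForm

variable {d L : ℕ} {G : Type*} [CommGroup G]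

/-- The additive link field of a configuration of an abelian lattice gauge theory on the torus:
`θ_U (x, i) = U(x, i)` read in `Additive G`. [folklore] -/
def linkField (U : GaugeConfig d L G) : Site d L → Fin d → Additive G :=
  fun x i => Additive.ofMul (U (x, i))

/-- The plaquette field of a configuration on the genuine plaquettes, additively:
`ω_U = dθ_U` restricted to `i < j`. [cite: ForsstromLenellsViklund2022, §2.3.2 (exterior derivative)] -/
def plaqField (U : GaugeConfig d L G) : Plaquette d L → Additive G :=
  res (td₁ (linkField U))

/-- `td₁` of the link field, on any index pair, is the plaquette holonomy. [folklore] -/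
theorem td₁_linkField (U : GaugeConfig d L G) (x : Site d L) (i j : Fin d) :
    td₁ (linkField U) x i j = Additive.ofMul (plaquetteHolonomy U x i j) := by
  simp only [td₁, linkField, plaquetteHolonomy, Site.shift, ofMul_mul, ofMul_inv]
  abel

/-- The additive plaquette field IS the plaquette holonomy: `ω_U(p) = U_p`. [folklore] -/
theorem plaqField_apply (U : GaugeConfig d L G) (p : Plaquette d L) :
    plaqField U p = Additive.ofMul (plaquetteHolonomy U p.1 p.2.1.1 p.2.1.2) := by
  simp only [plaqField, res, td₁_linkField]

/-- **Bianchi identity**: the plaquette field of a configuration is closed. [cite: ForsstromLenellsViklund2022, §2.3.2 (dd = 0)] -/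
theorem isClosedPl_plaqField (U : GaugeConfig d L G) : IsClosedPl (plaqField U) :=
  isClosedPl_res_td₁ _

/-- The plaquette field is multiplicative-to-additive: `ω_{UV} = ω_U + ω_V` (abelian group).
[folklore] -/
theorem plaqField_mul (U V : GaugeConfig d L G) : plaqField (U * V) = plaqField U + plaqField V := by
  funext p
  simp only [plaqField_apply, Pi.add_apply, Pi.mul_apply, plaquetteHolonomy, mul_inv_rev, ofMul_mul,
    ofMul_inv]
  abel

/-- The trivial configuration has trivial plaquette field. [folklore] -/
@[simp] theorem plaqField_one : plaqField (1 : GaugeConfig d L G) = 0 := by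
  funext p; simp [plaqField_apply, plaquetteHolonomy]

/-- `ω_{U⁻¹} = -ω_U`. [folklore] -/
theorem plaqField_inv (U : GaugeConfig d L G) : plaqField U⁻¹ = -plaqField U := by
  have h := plaqField_mul U U⁻¹
  rw [mul_inv_cancel, plaqField_one] at h
  exact (neg_eq_of_add_eq_zero_right h.symm).symm

/-- `ω_{U/V} = ω_U - ω_V`. [folklore] -/
theorem plaqField_div (U V : GaugeConfig d L G) : plaqField (U / V) = plaqField U - plaqField V := by
  rw [div_eq_mul_inv, plaqField_mul, plaqField_inv, sub_eq_add_neg]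

variable [Fintype G] [DecidableEq G] [NeZero L]

/-- **All non-empty fibres of `U ↦ ω_U` have the size of its kernel** (it is a homomorphism of
finite abelian groups: translate by a point of the fibre). [folklore] -/
theorem card_filter_plaqField_eq (U₀ : GaugeConfig d L G) :
    (Finset.univ.filter fun U : GaugeConfig d L G => plaqField U = plaqField U₀).card =
      (Finset.univ.filter fun U : GaugeConfig d L G => plaqField U = 0).card := by
  refine Finset.card_nbij' (fun U => U / U₀) (fun V => V * U₀) ?_ ?_ ?_ ?_
  · intro U hU
    simp only [Finset.coe_filter, Finset.mem_univ, true_and, Set.mem_setOf_eq] at hU ⊢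
    rw [plaqField_div, hU, sub_self]
  · intro V hV
    simp only [Finset.coe_filter, Finset.mem_univ, true_and, Set.mem_setOf_eq] at hV ⊢
    rw [plaqField_mul, hV, zero_add]
  · intro U _; simp
  · intro V _; simp

/-- **Sums over link configurations of functions of the plaquette field are sums over exact
plaquette fields**, each counted with the multiplicity `K = #{U : ω_U = 0}`:
`∑_U f(ω_U) = K · ∑_{η ∈ image ω} f(η)`. [cite: ForsstromLenellsViklund2022, §3 (the law of dσ as a measure on Ω²₀(B_N, G))] -/
theorem sum_comp_plaqField {M : Type*} [AddCommMonoid M] (f : (Plaquette d L → Additive G) → M) :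
    ∑ U : GaugeConfig d L G, f (plaqField U) =
      (Finset.univ.filter fun U : GaugeConfig d L G => plaqField U = 0).card •
        ∑ η ∈ Finset.univ.image (plaqField (d := d) (L := L) (G := G)), f η := by
  classical
  rw [Finset.sum_comp, Finset.smul_sum]
  refine Finset.sum_congr rfl fun η hη => ?_
  obtain ⟨U₀, -, rfl⟩ := Finset.mem_image.1 hη
  rw [card_filter_plaqField_eq U₀]

/-- The multiplicity `K = #{U : ω_U = 0}` is positive (the trivial configuration). [folklore] -/
theorem card_filter_plaqField_zero_pos :
    0 < (Finset.univ.filter fun U : GaugeConfig d L G => plaqField U = 0).card :=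
  Finset.card_pos.2 ⟨1, Finset.mem_filter.2 ⟨Finset.mem_univ _, plaqField_one⟩⟩

/-! ### Abelian Stokes theorem for rectangle holonomies -/

omit [Fintype G] [DecidableEq G] [NeZero L] in
/-- The straight-line holonomy, additively, is the line sum of the link field. [folklore] -/
theorem ofMul_lineHolonomy (U : GaugeConfig d L G) (k : Fin d) :
    ∀ (n : ℕ) (y : Site d L), Additive.ofMul (lineHolonomy U k n y) = lineSum (linkField U) k n y
  | 0, y => by simp [lineHolonomy, lineSum]
  | n + 1, y => by
    rw [lineHolonomy, lineSum, ofMul_mul, ofMul_lineHolonomy U k n]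
    rfl

omit [Fintype G] [DecidableEq G] [NeZero L] in
/-- `(n : ℤ/Lℤ) • eᵢ = Pi.single i n`. [folklore] -/
theorem natCast_smul_te (n : ℕ) (i : Fin d) :
    ((n : ZMod L) • te i : Site d L) = Pi.single i (n : ZMod L) := by
  funext m
  by_cases hm : m = i
  · subst hm; simp
  · simp [Pi.single_eq_of_ne hm]

omit [Fintype G] [DecidableEq G] [NeZero L] in
/-- **Abelian Stokes theorem** for the rectangle holonomy of Wave 0 (`rectangleHolonomy`): for an
abelian gauge group, the holonomy around the `R × T` rectangle at `x` in the `(i, j)` plane is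
the product of the plaquette holonomies of its `R T` plaquettes (additively: the boundary line
sum equals the sum of `td₁` over the rectangle, `lineSum_rect_eq_sum_td₁`). [folklore] -/
theorem ofMul_rectangleHolonomy (U : GaugeConfig d L G) (x : Site d L) (i j : Fin d) (R T : ℕ) :
    Additive.ofMul (rectangleHolonomy U x i j R T) =
      ∑ b ∈ Finset.range T, ∑ a ∈ Finset.range R,
        Additive.ofMul (plaquetteHolonomy U (x + (a : ZMod L) • te i + (b : ZMod L) • te j) i j) := by
  simp only [rectangleHolonomy, ofMul_mul, ofMul_inv, ofMul_lineHolonomy, ← natCast_smul_te,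
    ← td₁_linkField, ← lineSum_rect_eq_sum_td₁]
  abel

omit [Fintype G] [DecidableEq G] [NeZero L] in
/-- Multiplicative form of the abelian Stokes theorem. [folklore] -/
theorem rectangleHolonomy_eq_prod (U : GaugeConfig d L G) (x : Site d L) (i j : Fin d) (R T : ℕ) :
    rectangleHolonomy U x i j R T =
      ∏ b ∈ Finset.range T, ∏ a ∈ Finset.range R,
        plaquetteHolonomy U (x + (a : ZMod L) • te i + (b : ZMod L) • te j) i j := by
  apply Additive.ofMul.injective
  rw [ofMul_rectangleHolonomy]
  simp [ofMul_prod]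

end Abelian

/-! ### Gauge-invariant observables on `ℤ^d` are functions of the plaquette variables -/

section GaugeInvariant

open LatticeForm Literature.MathematicalPhysics.QuantumLattice

variable {d : ℕ} {G : Type*} [CommGroup G]

/-- Plaquette holonomies on `ℤ^d` are multiplicative in the configuration (abelian group).
[folklore] -/
theorem plaquetteHolonomyZd_div (U V : LGConfig d G) (x : Literature.Probability.LatticeModels.Site d)
    (i j : Fin d) :
    plaquetteHolonomyZd (V / U) x i j = plaquetteHolonomyZd V x i j / plaquetteHolonomyZd U x i j := by
  simp only [plaquetteHolonomyZd, Pi.div_apply]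
  apply Additive.ofMul.injective
  simp only [ofMul_mul, ofMul_inv, ofMul_div]
  abel

/-- **A gauge-invariant observable supported in a box depends on the configuration only through
its plaquette variables in the box.** If `F` is invariant under all gauge transformations of
`ℤ^d`, depends only on the edge variables of a finite edge set `S` all of whose edges lie in the
box `[a, b]`, and two configurations have the same plaquette holonomies on every plaquette of
the box, then `F` takes the same value on them: their quotient is flat on the box, hence a pure
gauge there (`exists_d₀_eq_of_flat_on_box`), so the two configurations are gauge equivalent on
`S`. [cite: ForsstromLenellsViklund2022, §2.3.3 (Lemma 2.2) with §1.2 (gauge invariant functions)] -/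
theorem IsZdGaugeInvariant.eq_of_plaquette_eq {α : Type*} {F : LGConfig d G → α}
    (hG : IsZdGaugeInvariant F) {S : Finset (ZdEdge d)} (hS : IsCylinder F S)
    {a b : Literature.Probability.LatticeModels.Site d}
    (hSbox : ∀ e ∈ S, e.1 ∈ Set.Icc a b ∧ e.1 + LatticeForm.e e.2 ∈ Set.Icc a b)
    {U V : LGConfig d G}
    (hUV : ∀ (x : Literature.Probability.LatticeModels.Site d) (i j : Fin d), x ∈ Set.Icc a b →
      x + LatticeForm.e i + LatticeForm.e j ∈ Set.Icc a b →
      plaquetteHolonomyZd U x i j = plaquetteHolonomyZd V x i j) :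
    F U = F V := by
  -- the quotient `W = V / U`, additively, is flat on the box
  set W : Literature.Probability.LatticeModels.Site d → Fin d → Additive G :=
    fun x i => Additive.ofMul ((V / U) (x, i)) with hW
  have hflat : ∀ (x : Literature.Probability.LatticeModels.Site d) (i j : Fin d), x ∈ Set.Icc a b →
      x + LatticeForm.e i + LatticeForm.e j ∈ Set.Icc a b → d₁ W x i j = 0 := by
    intro x i j hx hxij
    have h1 : d₁ W x i j = Additive.ofMul (plaquetteHolonomyZd (V / U) x i j) := by
      simp only [d₁, hW, plaquetteHolonomyZd, ofMul_mul, ofMul_inv]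
      abel
    rw [h1, plaquetteHolonomyZd_div, hUV x i j hx hxij, div_self', ofMul_one]
  obtain ⟨g, hg⟩ := exists_d₀_eq_of_flat_on_box W a b hflat
  -- the gauge transformation `γ = (toMul g)⁻¹` carries `U` to `V` on the edges of `S`
  set γ : Literature.Probability.LatticeModels.Site d → G := fun x => (Additive.toMul (g x))⁻¹ with hγ
  have hagree : ∀ e ∈ (S : Set (ZdEdge d)), gaugeTransformZd γ U e = V e := by
    intro e he
    obtain ⟨x, i⟩ := e
    obtain ⟨hx, hxi⟩ := hSbox (x, i) he
    have hd := hg x i hx hxi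
    simp only [d₀] at hd
    -- `g (x + eᵢ) - g x = W x i`, i.e. `toMul (g (x + eᵢ)) = toMul (g x) * (V (x,i) / U (x,i))`
    have hmul : Additive.toMul (g (x + LatticeForm.e i)) =
        Additive.toMul (g x) * (V (x, i) / U (x, i)) := by
      have h' : g (x + LatticeForm.e i) = g x + W x i := by rw [← hd]; abel
      have := congrArg Additive.toMul h'
      simpa [hW] using this
    show γ x * U (x, i) * (γ (x + Pi.single i 1))⁻¹ = V (x, i)
    simp only [hγ, inv_inv]
    rw [show x + Pi.single i (1 : ℤ) = x + LatticeForm.e i from rfl, hmul]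
    apply Additive.ofMul.injective
    simp only [ofMul_mul, ofMul_inv, ofMul_div]
    abel
  calc F U = F (gaugeTransformZd γ U) := (hG γ U).symm
    _ = F V := hS hagree

end GaugeInvariant

end Literature.MathematicalPhysics.QuantumFieldTheory

end
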